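import Literature.Analysis.Convexity.SignArrangementTriangulation
import HarnessLib

/-!
# Sign arrangements: the chain triangulation as an explicit complex

`Literature.Analysis.Convexity.SignArrangement.exists_simplicialComplex` produces the chain
triangulation of a sign arrangement as an existential statement.  For the subdivision theory of
PL topology (fine subdivisions of a complex, common refinements, pull-backs along simplexwise
affine maps) one needs to know *which* simplices occur: they are the images `C.image b` of the
nonempty chains `C ⊆ Φ` under the chosen-point map `b`.  This file exposes that description:

* `chainComplex L Φ b hb` — the chain triangulation as a `Geometry.SimplicialComplex`, with
  `mem_chainComplex_faces` characterising its faces as images of nonempty chains;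
* `chainComplex_faces_finite`, `image_mem_chainComplex_faces`;
* `exists_face_of_mem_face` — every point of a face `ε ∈ Φ` lies in a chain simplex whose chain
  has greatest element `ε` (so the simplex lies in the closed face `cl L ε`), and
  `convexHull_subset_cl_of_mem_chainComplex_faces` — every chain simplex lies in the closed face
  of the greatest element of its chain; `face_subset_chainComplex_space`;
* `cl_subset_closure_face` / `cl_eq_closure_face` — in finite dimension the closed face `cl L ε`
  of a nonempty face is the topological closure of `face L ε`.

All statements are standard (barycentric subdivision of the cell complex of an arrangement) and
tagged `[folklore]`.
-/

open Set Function

noncomputable section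

namespace Literature.Analysis.Convexity

namespace SignArrangement

section Explicit

variable {E : Type*} [AddCommGroup E] [Module ℝ E] {ι : Type*} [DecidableEq E]

/-- **The chain complex.** For finitely many affine functionals `L`, a finite family `Φ` of sign
vectors and chosen points `b ε ∈ face L ε` (`ε ∈ Φ`), the geometric simplicial complex whose
faces are the images `C.image b` of the nonempty chains `C ⊆ Φ` (for the face order `SLE`).
(The chosen points of a chain are affinely independent, `affineIndependent_of_isChain`, and two
chain simplices meet in a common face, `convexHull_image_inter_subset`.) [folklore] -/
def chainComplex (L : ι → E →ᵃ[ℝ] ℝ) (Φ : Finset (ι → SignType)) (b : (ι → SignType) → E)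
    (hb : ∀ ε ∈ Φ, b ε ∈ face L ε) : Geometry.SimplicialComplex ℝ E where
  faces := {t | ∃ C : Finset (ι → SignType), C ⊆ Φ ∧ C.Nonempty ∧
    IsChain SLE (C : Set (ι → SignType)) ∧ C.image b = t}
  isRelLowerSet_faces := by
    classical
    rintro _ ⟨C, hCΦ, hCne, hC, rfl⟩
    refine ⟨hCne.image b, fun t ht htne => ?_⟩
    refine ⟨C.filter fun G => b G ∈ t, (Finset.filter_subset _ _).trans hCΦ, ?_,
      hC.mono (Finset.coe_subset.2 (Finset.filter_subset _ _)), ?_⟩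
    · obtain ⟨y, hy⟩ := htne
      obtain ⟨G, hG, rfl⟩ := Finset.mem_image.1 (ht hy)
      exact ⟨G, Finset.mem_filter.2 ⟨hG, hy⟩⟩
    · ext y
      simp only [Finset.mem_image, Finset.mem_filter]
      constructor
      · rintro ⟨G, ⟨-, hGt⟩, rfl⟩
        exact hGt
      · intro hy
        obtain ⟨G, hG, rfl⟩ := Finset.mem_image.1 (ht hy)
        exact ⟨G, ⟨hG, hy⟩, rfl⟩
  indep := by
    classical
    rintro _ ⟨C, hCΦ, -, hC, rfl⟩
    exact affineIndependent_of_isChain hb C hCΦ hC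
  inter_subset_convexHull := by
    classical
    rintro _ _ ⟨C₁, h₁, -, hC₁, rfl⟩ ⟨C₂, h₂, -, hC₂, rfl⟩
    exact convexHull_image_inter_subset hb h₁ h₂ hC₁ hC₂

variable {L : ι → E →ᵃ[ℝ] ℝ} {Φ : Finset (ι → SignType)} {b : (ι → SignType) → E}
  {hb : ∀ ε ∈ Φ, b ε ∈ face L ε}

/-- The faces of the chain complex are the images of the nonempty chains. [folklore] -/
theorem mem_chainComplex_faces {t : Finset E} :
    t ∈ (chainComplex L Φ b hb).faces ↔ ∃ C : Finset (ι → SignType), C ⊆ Φ ∧ C.Nonempty ∧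
      IsChain SLE (C : Set (ι → SignType)) ∧ C.image b = t :=
  Iff.rfl

/-- The chain simplex of a nonempty chain in `Φ` is a face of the chain complex. [folklore] -/
theorem image_mem_chainComplex_faces {C : Finset (ι → SignType)} (hCΦ : C ⊆ Φ)
    (hCne : C.Nonempty) (hC : IsChain SLE (C : Set (ι → SignType))) :
    C.image b ∈ (chainComplex L Φ b hb).faces :=
  ⟨C, hCΦ, hCne, hC, rfl⟩

/-- The chain complex is finite. [folklore] -/
theorem chainComplex_faces_finite : (chainComplex L Φ b hb).faces.Finite := by
  classical
  refine ((Φ.powerset.image fun C => C.image b).finite_toSet).subset ?_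
  rintro _ ⟨C, hCΦ, -, -, rfl⟩
  exact Finset.mem_coe.2 (Finset.mem_image.2 ⟨C, Finset.mem_powerset.2 hCΦ, rfl⟩)

/-- The vertices of the chain complex are chosen points of faces in `Φ`. [folklore] -/
theorem exists_eq_of_mem_of_mem_chainComplex_faces {t : Finset E}
    (ht : t ∈ (chainComplex L Φ b hb).faces) {v : E} (hv : v ∈ t) : ∃ G ∈ Φ, b G = v := by
  obtain ⟨C, hCΦ, -, -, rfl⟩ := ht
  obtain ⟨G, hG, rfl⟩ := Finset.mem_image.1 hv
  exact ⟨G, hCΦ hG, rfl⟩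

/-- Every simplex of the chain complex lies in the closed face of the greatest element of its
chain, which belongs to `Φ`. [folklore] -/
theorem convexHull_subset_cl_of_mem_chainComplex_faces [DecidableEq ι] {t : Finset E}
    (ht : t ∈ (chainComplex L Φ b hb).faces) :
    ∃ ε ∈ Φ, b ε ∈ t ∧ convexHull ℝ (t : Set E) ⊆ cl L ε := by
  obtain ⟨C, hCΦ, hCne, hC, rfl⟩ := ht
  obtain ⟨F, hF, hmax⟩ := exists_max_of_isChain hC hCne
  exact ⟨F, hCΦ hF, Finset.mem_image_of_mem b hF, convexHull_image_subset_cl hb hCΦ hmax⟩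

/-- The underlying space of the chain complex is contained in the union of the closed faces of
`Φ`. [folklore] -/
theorem chainComplex_space_subset [DecidableEq ι] :
    (chainComplex L Φ b hb).space ⊆ ⋃ ε ∈ Φ, cl L ε := fun x hx => by
  obtain ⟨t, ht, hxt⟩ := Geometry.SimplicialComplex.mem_space_iff.1 hx
  obtain ⟨ε, hε, -, hsub⟩ := convexHull_subset_cl_of_mem_chainComplex_faces ht
  exact Set.mem_biUnion hε (hsub hxt)

end Explicit

section Covering

variable {E : Type*} [NormedAddCommGroup E] [NormedSpace ℝ E] [FiniteDimensional ℝ E]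
  {ι : Type*} [Finite ι] [DecidableEq E]
  {L : ι → E →ᵃ[ℝ] ℝ} {Φ : Finset (ι → SignType)} {b : (ι → SignType) → E}
  {hb : ∀ ε ∈ Φ, b ε ∈ face L ε}

/-- **Covering, sharp form.** If `Φ` is closed under passing to smaller sign vectors with
nonempty faces and its closed faces are bounded, every point of a face `ε ∈ Φ` lies in a simplex
of the chain complex contained in the closed face `cl L ε` (the chain has greatest element `ε`).
[folklore] -/
theorem exists_face_of_mem_face
    (hdown : ∀ ε ∈ Φ, ∀ ε', SLE ε' ε → (face L ε').Nonempty → ε' ∈ Φ)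
    (hbdd : ∀ ε ∈ Φ, Bornology.IsBounded (cl L ε)) {ε : ι → SignType} (hε : ε ∈ Φ) {x : E}
    (hx : x ∈ face L ε) :
    ∃ t ∈ (chainComplex L Φ b hb).faces, b ε ∈ t ∧ x ∈ convexHull ℝ (t : Set E) ∧
      convexHull ℝ (t : Set E) ⊆ cl L ε := by
  classical
  obtain ⟨C, hCΦ, hεC, hC, hmax, hxC⟩ := exists_chain_mem_convexHull hb hdown hbdd ε hε x hx
  exact ⟨C.image b, ⟨C, hCΦ, ⟨ε, hεC⟩, hC, rfl⟩, Finset.mem_image_of_mem b hεC, hxC,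
    convexHull_image_subset_cl hb hCΦ hmax⟩

/-- The underlying space of the chain complex contains every face in `Φ`. [folklore] -/
theorem face_subset_chainComplex_space
    (hdown : ∀ ε ∈ Φ, ∀ ε', SLE ε' ε → (face L ε').Nonempty → ε' ∈ Φ)
    (hbdd : ∀ ε ∈ Φ, Bornology.IsBounded (cl L ε)) {ε : ι → SignType} (hε : ε ∈ Φ) :
    face L ε ⊆ (chainComplex L Φ b hb).space := fun _ hx => by
  obtain ⟨t, ht, -, hxt, -⟩ := exists_face_of_mem_face hdown hbdd hε hx
  exact Geometry.SimplicialComplex.convexHull_subset_space ht hxt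

end Covering

/-! ### Closed faces are closures of faces -/

section Closure

variable {E : Type*} [NormedAddCommGroup E] [NormedSpace ℝ E] {ι : Type*}
  {L : ι → E →ᵃ[ℝ] ℝ} {ε : ι → SignType}

/-- The closed face of a *nonempty* face lies in the closure of the face: the open segment from
a point of the closed face to a point of the face lies in the face (`combo_mem_face`).
[folklore] -/
theorem cl_subset_closure_face {p : E} (hp : p ∈ face L ε) : cl L ε ⊆ closure (face L ε) := by
  intro x hx
  rw [Metric.mem_closure_iff]
  intro δ hδ
  -- points `(1 - s) • x + s • p` with small `s > 0` lie in the face and are close to `x`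
  obtain ⟨s, hs0, hs1, hsδ⟩ : ∃ s : ℝ, 0 < s ∧ s ≤ 1 ∧ s * dist p x < δ := by
    refine ⟨min 1 (δ / (2 * (dist p x + 1))), lt_min one_pos (by positivity), min_le_left _ _, ?_⟩
    have h1 : min 1 (δ / (2 * (dist p x + 1))) * dist p x ≤ δ / (2 * (dist p x + 1)) * dist p x :=
      mul_le_mul_of_nonneg_right (min_le_right _ _) dist_nonneg
    have h2 : δ / (2 * (dist p x + 1)) * dist p x < δ := by
      rw [div_mul_eq_mul_div, div_lt_iff₀ (by positivity)]
      nlinarith [dist_nonneg (x := p) (y := x)]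
    exact h1.trans_lt h2
  refine ⟨s • p + (1 - s) • x, combo_mem_face hp hx hs0 (by linarith) (by ring), ?_⟩
  have : x - (s • p + (1 - s) • x) = s • (x - p) := by
    rw [sub_smul, one_smul, smul_sub]; abel
  rw [dist_eq_norm, this, norm_smul, Real.norm_of_nonneg hs0.le, ← dist_eq_norm, dist_comm]
  exact hsδ

variable [FiniteDimensional ℝ E]

/-- In finite dimension the closed face of a nonempty face *is* the closure of the face
(`isClosed_cl` and `cl_subset_closure_face`). [folklore] -/
theorem cl_eq_closure_face {p : E} (hp : p ∈ face L ε) : cl L ε = closure (face L ε) :=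
  Subset.antisymm (cl_subset_closure_face hp)
    (closure_minimal face_subset_cl (isClosed_cl L ε))

end Closure

end SignArrangement

end Literature.Analysis.Convexity
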